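/-
Copyright: literature formalisation for the harness. Statements follow the cited text.
-/
import Literature.AlgebraicGeometry.CossartPiltant200819.PrimaryContraction2008
import Literature.AlgebraicGeometry.CossartPiltant200819.NormalModelAbove2008
import Literature.AlgebraicGeometry.CossartPiltant200819.ConjugateStability2008
import HarnessLib

/-!
# Cossart–Piltant 2008, Lemma 9.4 (journal 9.2), case `e = l`: the assembly from PRINTED leaves

Bookkeeping only (one-line compositions). After `NormalModelAbove2008.normalModelAboveLe_holds`
(`R̃₀ ⊆` a local model of `W`: `CP2008.NormalModelAboveLe` PROVED) and
`ConjugateStability2008.conjugateStability_holds` (the criterion `CP2008.ConjugateStability`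
PROVED), the assemblies of `StableModelCriterion2008.lean` / `PrimaryContraction2008.lean` lose
both cell-made bookkeeping binders. What remains behind Lemma 9.4 (`CP2008.TamePrimeDescent`,
itself the cited named fact of the printed lemma) is, over an arbitrary ground field `k`
(the lemma's hypotheses `[L : K] = l` prime, `l ≠ char k` unchanged):
* `DescentBelowInertiaField` — Prop 9.3 (printed statement);
* `TamePrimeDescentViaStableModel` — the argument of HAL p. 30, l. 16–65 (printed);
* `Cofinality` — Cor 4.6 (printed);
* `PrimaryTransformRankOne` — this directory's transport of [Fu1997, Thm 3.6] to an arbitrary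
  ground field (prose (T0)–(T5) in `PrimaryContraction2008.lean`; for `k = k̄` it is Fu's printed
  theorem, `primaryTransformRankOne_of_fu_of_isAlgClosed`), resp. `FuPrimaryTransform` itself in
  the `k = k̄` corollary;
* `GStableUniformizationInertialRankOne` — the OPEN residual of (S3\*) in rational rank one
  (not established in print; no counterexample known).
Nothing in this file is a new mathematical claim; no statement of [CP2008] is asserted.

## Sources
- [CossartPiltant2008] HAL hal-00139124v1: Lemma 9.4 and its proof (p. 29–30), Prop 9.3, Cor 4.6.
- [Fu1997] D. Fu, Local weak simultaneous resolution for high rational ranks, J. Algebra 194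
  (1997) 614–630, Thm 3.6.
-/

namespace Literature.AlgebraicGeometry.CossartPiltant200819.CP2008

open Literature.AlgebraicGeometry.Resolution
open scoped Pointwise IntermediateField

universe u

/-- **(S3\*) for `W` fixed by `Gal(L/K)`, any `k`, rank one, `rat.rk W ≥ 2`, from printed leaves
and the transport** (PROVED bookkeeping): `gStableUniformizationAbove_of_primary_rankOne` with
`NormalModelAboveLe` and `ConjugateStability` discharged by their proofs.
[cite: CossartPiltant2008, Lemma 9.4 proof (HAL p. 30, l. 14–16), Cor 4.6 (HAL p. 15)] -/
theorem gStableUniformizationAbove_of_printed_leaves_rankOne (hcof : Cofinality.{u})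
    (hFu : PrimaryTransformRankOne.{u})
    {k K : Type u} [Field k] [Field K] [Algebra k K]
    (hfg : (⊤ : IntermediateField k K).FG) (htr : Algebra.trdeg k K = 3)
    {L : Type u} [Field L] [Algebra K L] [Algebra k L] [IsScalarTower k K L]
    [FiniteDimensional K L] (W : ValuationSubring L) (hk : ∀ c : k, algebraMap k L c ∈ W)
    (hrk : Nonempty W.valuation.RankOne) (hres : residueTrdeg k W hk = 0)
    (hrr : (2 : Cardinal) ≤ ratRank W)
    (hfix : ∀ σ : L ≃ₐ[K] L, σ • W = W) (hLU : IsLocallyUniformizable k L W)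
    (R₀ : Subalgebra k K) (hR₀ : IsNormalLocalModelOf k K (W.comap (algebraMap K L)) R₀) :
    GStableUniformizationAbove (K := K) W R₀ :=
  gStableUniformizationAbove_of_primary_rankOne hcof normalModelAboveLe_holds hFu
    conjugateStability_holds hfg htr W hk hrk hres hrr hfix hLU R₀ hR₀

/-- **Lemma 9.4 restricted to `rat.rk W ≥ 2`, any `k`, from printed leaves and the transport**
(PROVED bookkeeping). [cite: CossartPiltant2008, Lemma 9.4 (HAL p. 29–30)] -/
theorem tamePrimeDescentRatRankTwo_of_printed_leaves (h93 : DescentBelowInertiaField.{u})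
    (h₁ : TamePrimeDescentViaStableModel.{u}) (hcof : Cofinality.{u})
    (hFu : PrimaryTransformRankOne.{u}) : TamePrimeDescentRatRankTwo.{u} :=
  tamePrimeDescentRatRankTwo_of_leaves h93 h₁ hcof normalModelAboveLe_holds hFu
    conjugateStability_holds

/-- **Lemma 9.4 for `k = k̄`, `rat.rk W ≥ 2`, from PRINTED statements only** (PROVED
bookkeeping): Prop 9.3, HAL p. 30 l. 16–65, Cor 4.6 and [Fu1997, Thm 3.6].
[cite: CossartPiltant2008, Lemma 9.4 (HAL p. 29–30); Fu1997, Thm 3.6] -/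
theorem tamePrimeDescentHighRank_of_printed_leaves (h93 : DescentBelowInertiaField.{u})
    (h₁ : TamePrimeDescentViaStableModel.{u}) (hcof : Cofinality.{u})
    (hFu : FuPrimaryTransform.{u}) : TamePrimeDescentHighRank.{u} :=
  tamePrimeDescentHighRank_of_leaves h93 h₁ hcof normalModelAboveLe_holds hFu
    conjugateStability_holds

/-- **(S3\*) for inertial `W`, any `k`, from printed leaves, the transport and the rank-one
residual** (PROVED bookkeeping).
[cite: CossartPiltant2008, Lemma 9.4 proof (HAL p. 30, l. 11–16)] -/
theorem gStableUniformizationInertial_of_printed_leaves (hcof : Cofinality.{u})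
    (hFu : PrimaryTransformRankOne.{u}) (h1 : GStableUniformizationInertialRankOne.{u}) :
    GStableUniformizationInertial.{u} :=
  gStableUniformizationInertial_of_leaves hcof normalModelAboveLe_holds hFu
    conjugateStability_holds h1

/-- **Lemma 9.4 (`TamePrimeDescent`) over an arbitrary ground field from printed leaves, the
transport and the rank-one residual** (PROVED bookkeeping): the dependency statement of the
directory for the case `e = l` — Lemma 9.4 ⇐ {Prop 9.3, HAL p. 30 l. 16–65, Cor 4.6,
`PrimaryTransformRankOne`, (S3\*) in rational rank one}.
[cite: CossartPiltant2008, Lemma 9.4 (HAL p. 29–30)] -/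
theorem tamePrimeDescent_of_printed_leaves (h93 : DescentBelowInertiaField.{u})
    (h₁ : TamePrimeDescentViaStableModel.{u}) (hcof : Cofinality.{u})
    (hFu : PrimaryTransformRankOne.{u}) (h1 : GStableUniformizationInertialRankOne.{u}) :
    TamePrimeDescent.{u} :=
  tamePrimeDescent_of_leaves_of_rankOne h93 h₁ hcof normalModelAboveLe_holds hFu
    conjugateStability_holds h1

end Literature.AlgebraicGeometry.CossartPiltant200819.CP2008
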